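import Literature.Combinatorics.LorentzianPolynomials.MatroidBases
import HarnessLib

/-!
# Brändén–Huh's Theorem 3.10: a subset `J ⊆ Δ^d_n` is M-convex iff its generating function `f_J = Σ_{α ∈ J} w^α/α!`
# is Lorentzian iff `J` is the support of a Lorentzian polynomial

Layer `Literature/Combinatorics/LorentzianPolynomials`, namespace `Literature.Combinatorics.LorentzianPolynomials`;
lane `lit-hodgefound` (Track 2 foundations library), seat p16, generation 27 (row g27-#11). Sequel of `MatroidBases.lean`
(row g27-#10: the `0/1` case — basis generating polynomials of matroids; `IsMConvex.vadd_mem`, `nonadj_trans_of_isMConvex`,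
`sigPos_le_one_of_nonadj_trans`), `Quadratic.lean` (row g27-#7: Theorem 2.25 as the criterion
`mem_lorentzian_iff_forall_sigPos_hessian`) and `Basic.lean` (row g27-#1: `isMConvex_support_of_mem_lorentzian`, i.e.
(1) ⇒ (3) of Theorem 3.10).

## Source (verbatim) — P. Brändén, J. Huh, *Lorentzian polynomials* [BrandenHuh2019] (held `paper:arxiv-1902.03719`)

* §3.2 **Theorem 3.10**: "The following conditions are equivalent for any nonempty `J ⊆ Δ^d_n`: (1) There is a Lorentzian
  polynomial whose support is `J`. (2) `f_J = Σ_{α ∈ J} w^α/α!` is Lorentzian. (3) `J` is M-convex."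
* §2.2 (p. 11): M-convex sets (the exchange property); Definition 2.6; §2.4 Theorem 2.25.

## The proof of (3) ⇒ (2) formalized here

`f_J` has normalized coefficients `c_α = [α ∈ J]`, so `f_J ∈ M^d_n`, and for `β ∈ Δ^{d-2}` the Hessian of `∂^β f_J` is the
`0/1` matrix `A_{ij} = [β + e_i + e_j ∈ J]` — the adjacency matrix, WITH LOOPS (`β + 2e_i ∈ J`), of the M-convex set
`K = J - β ⊆ Δ²_n`. The exchange property of `K` forces: (a) a loop `i` is adjacent to every non-isolated vertex
(`hloop_of_isMConvex`); (b) among non-loops, non-adjacency is transitive through non-isolated vertices (row g27-#10's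
`nonadj_trans_of_isMConvex`). Hence, with `V'` the non-isolated vertices and `N ⊆ V'` the non-loops partitioned into the
classes `C` of non-adjacency, `xᵀ A x = (Σ_{V'} x_i)² - Σ_C (Σ_C x_i)²`, non-positive on the hyperplane `Σ_{V'} x_i = 0`; by
Sylvester `sigPos A ≤ 1` (`sigPos_le_one_of_loops`), and Theorem 2.25's criterion concludes.

## What is here

* §1 **`sigPos_le_one_of_loops`**: adjacency matrices (loops allowed) with (a), (b) have at most one positive eigenvalue —
  the generalization of row g27-#10's `sigPos_le_one_of_nonadj_trans`.
* §2 `hloop_of_isMConvex` ((a) from the exchange property).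
* §3 `genPolyNorm J = Σ_{α∈J} w^α/α!` (`coeff_`/`normCoeff_`/`support_`/`isHomogeneous_genPolyNorm`, `hessian_iterPderiv_genPolyNorm`)
  and **`genPolyNorm_mem_lorentzian`** ((3) ⇒ (2)).
* §4 **`isMConvex_iff_genPolyNorm_mem_lorentzian`** ((3) ⇔ (2)) and **`isMConvex_iff_exists_support_eq`** ((3) ⇔ (1)) —
  Theorem 3.10 for `J ⊆ Δ^d_n` (the empty `J` included: `f_∅ = 0` is Lorentzian and `∅` is M-convex).

One definition with body (`genPolyNorm`), theorems otherwise; no `sorry`, no named fact (net debt 0).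

## References

* [BrandenHuh2019] P. Brändén, J. Huh, *Lorentzian polynomials*, Ann. of Math. (2) 192 (2020) 821–891, arXiv:1902.03719 —
  §3.2 Thm. 3.10; §2.2 (p. 11), Def. 2.6; §2.4 Thm. 2.25.
-/

noncomputable section

open MvPolynomial Finsupp Finset
open scoped Nat

namespace Literature.Combinatorics.LorentzianPolynomials

variable {σ : Type*}

/-! ## §1 Adjacency matrices with loops: loops see everything, non-adjacency of non-loops transitive -/

section Loops

variable [Fintype σ] [DecidableEq σ] (A : σ → σ → Prop) [DecidableRel A]

/-- **Adjacency matrices with at most one positive eigenvalue (loops allowed).** Let `A` be a symmetric relation on a finite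
set such that (a) every loop `i` (`A i i`) is adjacent to every non-isolated vertex, and (b) for non-loops `i, k` and a
non-isolated `j`: `i ≁ j`, `j ≁ k ⟹ i ≁ k`. Then the `0/1` matrix `([A i j])` has `sigPos ≤ 1`: with `V'` the non-isolated
vertices and the non-loops `N ⊆ V'` split into classes `C` of `≁`, `xᵀ A x = (Σ_{V'} x)² - Σ_C (Σ_C x)² ≤ 0` on `Σ_{V'} x = 0`
(Sylvester, Mathlib's `QuadraticForm.sigPos_add_finrank_le_of_nonpos`). [cite: BrandenHuh2019, §3.2 proof of Thm. 3.10 (the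
quadratic case); §2.1 Lemma 2.5] -/
theorem sigPos_le_one_of_loops (hsymm : ∀ i j, A i j → A j i)
    (hloop : ∀ i j, A i i → (∃ l, A j l) → A i j)
    (htrans : ∀ i j k, ¬ A i i → ¬ A k k → (∃ l, A j l) → ¬ A i j → ¬ A j k → ¬ A i k) :
    sigPos (Matrix.toBilin' (Matrix.of fun i j ↦ if A i j then (1 : ℝ) else 0)).toQuadraticMap ≤ 1 := by
  set Q := (Matrix.toBilin' (Matrix.of fun i j ↦ if A i j then (1 : ℝ) else 0)).toQuadraticMap with hQ
  -- non-isolated vertices `V`, non-loops `N ⊆ V`, classes of non-adjacency on `N`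
  set V : Finset σ := Finset.univ.filter fun i ↦ ∃ j, A i j with hV
  have hV' : ∀ {i j}, A i j → i ∈ V := fun {i j} h ↦ by rw [hV, Finset.mem_filter]; exact ⟨Finset.mem_univ _, j, h⟩
  have hVex : ∀ {i}, i ∈ V → ∃ j, A i j := fun {i} h ↦ (Finset.mem_filter.1 h).2
  set N : Finset σ := V.filter fun i ↦ ¬ A i i with hN
  have hmemN : ∀ {i}, i ∈ N ↔ i ∈ V ∧ ¬ A i i := fun {i} ↦ by rw [hN, Finset.mem_filter]
  set cls : σ → Finset σ := fun i ↦ N.filter fun j ↦ ¬ A i j with hcls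
  have hmem_cls : ∀ {i j}, j ∈ cls i ↔ j ∈ N ∧ ¬ A i j := fun {i j} ↦ by rw [hcls, Finset.mem_filter]
  -- make `V`, `N`, `cls` opaque (their characterizations above are all that is used)
  clear_value cls N V
  have hself : ∀ {i}, i ∈ N → i ∈ cls i := fun {i} hi ↦ hmem_cls.2 ⟨hi, (hmemN.1 hi).2⟩
  have hcls_eq : ∀ {i j}, i ∈ N → j ∈ cls i → cls j = cls i := by
    intro i j hi hj
    obtain ⟨hjN, hij⟩ := hmem_cls.1 hj
    obtain ⟨hiV, hii⟩ := hmemN.1 hi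
    obtain ⟨hjV, hjj⟩ := hmemN.1 hjN
    have hji : ¬ A j i := fun h ↦ hij (hsymm _ _ h)
    ext k
    rw [hmem_cls, hmem_cls]
    constructor
    · rintro ⟨hk, hjk⟩
      exact ⟨hk, htrans i j k hii (hmemN.1 hk).2 (hVex hjV) hij hjk⟩
    · rintro ⟨hk, hik⟩
      exact ⟨hk, htrans j i k hjj (hmemN.1 hk).2 (hVex hiV) hji hik⟩
  -- a non-loop of `V` is non-adjacent only to non-loops
  have hnonadj_N : ∀ {i j}, i ∈ V → j ∈ V → ¬ A i j → j ∈ N := fun {i j} hi hj hij ↦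
    hmemN.2 ⟨hj, fun hjj ↦ hij (hsymm _ _ (hloop j i hjj (hVex hi)))⟩
  set ℓ : (σ → ℝ) →ₗ[ℝ] ℝ := ∑ i ∈ V, LinearMap.proj i with hℓ
  have hℓx : ∀ x : σ → ℝ, ℓ x = ∑ i ∈ V, x i := fun x ↦ by rw [hℓ, LinearMap.sum_apply]; rfl
  -- `Σ_{i ∈ N} x_i T_i = Σ_C T_C² ≥ 0`
  have hP : ∀ x : σ → ℝ, 0 ≤ ∑ i ∈ N, x i * ∑ j ∈ cls i, x j := by
    intro x
    rw [← Finset.sum_image' (s := N) (g := cls) (f := fun C ↦ (∑ j ∈ C, x j) * ∑ j ∈ C, x j)]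
    · exact Finset.sum_nonneg fun C _ ↦ mul_self_nonneg _
    · intro i hi
      have hfib : N.filter (fun j ↦ cls j = cls i) = cls i := by
        ext j
        rw [Finset.mem_filter, hmem_cls]
        constructor
        · rintro ⟨hjN, hj⟩
          have := hself hjN
          rw [hj] at this
          exact ⟨hjN, (hmem_cls.1 this).2⟩
        · rintro ⟨hjN, hij⟩
          exact ⟨hjN, hcls_eq hi (hmem_cls.2 ⟨hjN, hij⟩)⟩
      rw [hfib, Finset.sum_mul]
      refine Finset.sum_congr rfl fun j hj ↦ ?_
      rw [hcls_eq hi hj]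
  -- `Q x = (Σ_V x)² - Σ_{i ∈ N} x_i T_i`
  have hQx : ∀ x : σ → ℝ, Q x = (∑ i ∈ V, x i) * (∑ i ∈ V, x i) - ∑ i ∈ N, x i * ∑ j ∈ cls i, x j := by
    intro x
    -- write the `N`-sum as a `V`-sum
    have hNV : ∑ i ∈ N, x i * ∑ j ∈ cls i, x j = ∑ i ∈ V, if ¬ A i i then x i * ∑ j ∈ cls i, x j else 0 := by
      rw [hN, Finset.sum_filter]
    rw [hNV, hQ, LinearMap.BilinMap.toQuadraticMap_apply, Matrix.toBilin'_apply, Finset.sum_mul, ← Finset.sum_sub_distrib]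
    rw [← Finset.sum_subset (Finset.subset_univ V) fun i _ hi ↦ ?_]
    · refine Finset.sum_congr rfl fun i hi ↦ ?_
      -- row `i ∈ V`: `Σ_j [A i j] x_i x_j = x_i Σ_V x - [i ∈ N] x_i T_i`
      have hrow : ∑ j, x i * (Matrix.of (fun i j ↦ if A i j then (1 : ℝ) else 0)) i j * x j =
          ∑ j ∈ V, (x i * x j - if ¬ A i j then x i * x j else 0) := by
        rw [← Finset.sum_subset (Finset.subset_univ V) fun j _ hj ↦ ?_]
        · refine Finset.sum_congr rfl fun j _ ↦ ?_
          rw [Matrix.of_apply]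
          by_cases h : A i j
          · rw [if_pos h, if_neg (not_not.2 h)]; ring
          · rw [if_neg h, if_pos h]; ring
        · rw [Matrix.of_apply, if_neg (fun h ↦ hj (hV' (hsymm _ _ h))), mul_zero, zero_mul]
      rw [hrow, Finset.sum_sub_distrib, ← Finset.mul_sum]
      congr 1
      by_cases hii : A i i
      · -- a loop sees all of `V`
        rw [if_neg (not_not.2 hii)]
        exact Finset.sum_eq_zero fun j hj ↦ if_neg (not_not.2 (hloop i j hii (hVex hj)))
      · rw [if_pos hii, Finset.mul_sum]
        -- `{j ∈ V : i ≁ j} = cls i`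
        have hclsV : cls i = V.filter fun j ↦ ¬ A i j := by
          apply Finset.ext
          intro j
          rw [hmem_cls, Finset.mem_filter]
          exact ⟨fun h ↦ ⟨(hmemN.1 h.1).1, h.2⟩, fun h ↦ ⟨hnonadj_N hi h.1 h.2, h.2⟩⟩
        rw [hclsV, Finset.sum_filter]
    · refine Finset.sum_eq_zero fun j _ ↦ ?_
      rw [Matrix.of_apply, if_neg (fun h ↦ hi (hV' h)), mul_zero, zero_mul]
  have hNker : ∀ x ∈ LinearMap.ker ℓ, Q x ≤ 0 := fun x hx ↦ by
    rw [LinearMap.mem_ker, hℓx] at hx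
    rw [hQx, hx, mul_zero, zero_sub, neg_nonpos]
    exact hP x
  have h2 := QuadraticForm.sigPos_add_finrank_le_of_nonpos hNker
  have hr : Module.finrank ℝ (LinearMap.range ℓ) ≤ 1 :=
    (Submodule.finrank_le _).trans (Module.finrank_self ℝ).le
  have h3 := ℓ.finrank_range_add_finrank_ker
  omega

end Loops

/-! ## §2 In an M-convex `K ⊆ Δ²`, a loop is adjacent to every non-isolated vertex -/

section Structure

variable [DecidableEq σ]

/-- **Loops see everything**: for `J` M-convex and any `β`, if `β + 2e_i ∈ J` and `β + e_j + e_l ∈ J` for some `l`, then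
`β + e_i + e_j ∈ J` (two exchanges: first at `i` between `2e_i` and `e_j + e_l`, and if that yields `e_i + e_l`, once more at
`l` between `e_j + e_l` and `2e_i`). [cite: BrandenHuh2019, §2.2 (p. 11, exchange property); §3.2 proof of Thm. 3.10] -/
theorem hloop_of_isMConvex {J : Finset (σ →₀ ℕ)} (hM : IsMConvex (J : Set (σ →₀ ℕ))) (β : σ →₀ ℕ) (i j : σ)
    (hii : β + Finsupp.single i 1 + Finsupp.single i 1 ∈ J) (hj : ∃ l, β + Finsupp.single j 1 + Finsupp.single l 1 ∈ J) :
    β + Finsupp.single i 1 + Finsupp.single j 1 ∈ J := by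
  by_cases hji : j = i
  · subst hji; exact hii
  obtain ⟨l, hl⟩ := hj
  have hK := hM.vadd_mem β
  have hγ : Finsupp.single i 1 + Finsupp.single i 1 ∈ {γ : σ →₀ ℕ | β + γ ∈ (J : Set (σ →₀ ℕ))} := by
    rw [Set.mem_setOf_eq, ← add_assoc]; exact hii
  have hδ : Finsupp.single j 1 + Finsupp.single l 1 ∈ {γ : σ →₀ ℕ | β + γ ∈ (J : Set (σ →₀ ℕ))} := by
    rw [Set.mem_setOf_eq, ← add_assoc]; exact hl
  -- first exchange, at `i`
  obtain ⟨m, hm, hmem⟩ := hK hγ hδ i (by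
    simp only [Finsupp.add_apply, Finsupp.single_apply, if_true, if_neg hji]
    split_ifs <;> omega)
  simp only [Finsupp.add_apply, Finsupp.single_apply] at hm
  have hmi : m ≠ i := by rintro rfl; simp only [if_true] at hm; split_ifs at hm <;> omega
  have hmjl : m = j ∨ m = l := by
    by_contra h; push Not at h
    rw [if_neg (Ne.symm h.1), if_neg (Ne.symm h.2)] at hm; omega
  rw [add_tsub_cancel_right, Set.mem_setOf_eq, ← add_assoc, Finset.mem_coe] at hmem
  rcases hmjl with rfl | rfl
  · exact hmem
  · -- `e_i + e_l ∈ K` with `l ≠ i`; second exchange, at `l`, between `e_j + e_l` and `2e_i`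
    have hγ' : Finsupp.single i 1 + Finsupp.single m 1 ∈ {γ : σ →₀ ℕ | β + γ ∈ (J : Set (σ →₀ ℕ))} := by
      rw [Set.mem_setOf_eq, ← add_assoc]; exact hmem
    obtain ⟨m', hm', hmem'⟩ := hK hδ hγ m (by
      simp only [Finsupp.add_apply, Finsupp.single_apply, if_true, if_neg hmi.symm]
      split_ifs <;> omega)
    simp only [Finsupp.add_apply, Finsupp.single_apply] at hm'
    have hm'i : m' = i := by
      by_contra h
      have h1 : (if i = m' then 1 else 0 : ℕ) = 0 := if_neg (Ne.symm h)
      rw [h1] at hm'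
      split_ifs at hm' <;> omega
    subst hm'i
    rw [add_tsub_cancel_right, Set.mem_setOf_eq, ← add_assoc, Finset.mem_coe, add_right_comm] at hmem'
    exact hmem'

end Structure

/-! ## §3 `f_J = Σ_{α ∈ J} w^α/α!` and Theorem 3.10 (3) ⇒ (2) -/

section GenPolyNorm

variable [Fintype σ]

/-- **The generating function `f_J = Σ_{α ∈ J} w^α/α!`** of a finite `J ⊆ ℕ^n`. [cite: BrandenHuh2019, §3.2 Thm. 3.10
("`f_J = Σ_{α ∈ J} w^α/α!`")] -/
def genPolyNorm (J : Finset (σ →₀ ℕ)) : MvPolynomial σ ℝ := ∑ α ∈ J, monomial α (factorialProd α)⁻¹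

/-- `f_J` unfolded. [cite: BrandenHuh2019, §3.2 Thm. 3.10] -/
theorem genPolyNorm_def (J : Finset (σ →₀ ℕ)) : genPolyNorm J = ∑ α ∈ J, monomial α (factorialProd α)⁻¹ := rfl

variable [DecidableEq σ]

/-- `coeff_β f_J = [β ∈ J]/β!`. [cite: BrandenHuh2019, §3.2 Thm. 3.10] -/
theorem coeff_genPolyNorm (J : Finset (σ →₀ ℕ)) (β : σ →₀ ℕ) :
    coeff β (genPolyNorm J) = if β ∈ J then (factorialProd β)⁻¹ else 0 := by
  rw [genPolyNorm, coeff_sum]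
  simp_rw [coeff_monomial]
  exact Finset.sum_ite_eq' J β fun γ ↦ (factorialProd γ)⁻¹

/-- **`c_β(f_J) = [β ∈ J]`**: the normalized coefficients of `f_J` are the indicator of `J`. [cite: BrandenHuh2019, §3.2
Thm. 3.10; §2.2 (p. 11, normalized form `Σ (c_α/α!) w^α`)] -/
theorem normCoeff_genPolyNorm (J : Finset (σ →₀ ℕ)) (β : σ →₀ ℕ) :
    normCoeff β (genPolyNorm J) = if β ∈ J then 1 else 0 := by
  rw [normCoeff, coeff_genPolyNorm]
  split_ifs
  · exact mul_inv_cancel₀ (factorialProd_ne_zero β)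
  · exact mul_zero _

/-- The coefficients of `f_J` are nonnegative. [cite: BrandenHuh2019, §3.2 Thm. 3.10] -/
theorem coeff_genPolyNorm_nonneg (J : Finset (σ →₀ ℕ)) (β : σ →₀ ℕ) : 0 ≤ coeff β (genPolyNorm J) := by
  rw [coeff_genPolyNorm]
  split_ifs
  · exact inv_nonneg.2 (factorialProd_pos β).le
  · exact le_rfl

/-- `supp f_J = J`. [cite: BrandenHuh2019, §3.2 Thm. 3.10] -/
theorem support_genPolyNorm (J : Finset (σ →₀ ℕ)) : {β : σ →₀ ℕ | coeff β (genPolyNorm J) ≠ 0} = (J : Set (σ →₀ ℕ)) := by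
  ext β
  rw [Set.mem_setOf_eq, coeff_genPolyNorm, Finset.mem_coe]
  split_ifs with h
  · simp only [ne_eq, inv_eq_zero, factorialProd_ne_zero, not_false_eq_true, h]
  · simp [h]

omit [DecidableEq σ] in
/-- `f_J` is homogeneous of degree `d` for `J ⊆ Δ^d`. [cite: BrandenHuh2019, §3.2 Thm. 3.10 ("`J ⊆ Δ^d_n`")] -/
theorem isHomogeneous_genPolyNorm {J : Finset (σ →₀ ℕ)} {d : ℕ} (hJd : ∀ α ∈ J, α.degree = d) :
    (genPolyNorm J).IsHomogeneous d := by
  rw [genPolyNorm]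
  exact IsHomogeneous.sum _ _ _ fun α hα ↦ isHomogeneous_monomial _ (hJd α hα)

/-- The Hessian of `∂^β f_J` is the adjacency matrix with loops of `J - β`: `(𝓗_{∂^β f_J})_{ij} = [β + e_i + e_j ∈ J]`.
[cite: BrandenHuh2019, §3.2 proof of Thm. 3.10; §2.4 Thm. 2.25] -/
theorem hessian_iterPderiv_genPolyNorm (J : Finset (σ →₀ ℕ)) (β : σ →₀ ℕ) :
    hessian (iterPderiv β (genPolyNorm J)) =
      Matrix.of fun i j ↦ if β + Finsupp.single i 1 + Finsupp.single j 1 ∈ J then (1 : ℝ) else 0 := by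
  rw [hessian_iterPderiv_eq]
  ext i j
  rw [Matrix.of_apply, Matrix.of_apply, normCoeff_genPolyNorm]

/-- **Brändén–Huh, Theorem 3.10, (3) ⇒ (2): the generating function `f_J = Σ_{α∈J} w^α/α!` of an M-convex `J ⊆ Δ^d_n` is
Lorentzian.** By Theorem 2.25's criterion; each `𝓗_{∂^β f_J}` is an adjacency matrix with loops satisfying (a) loops see all
non-isolated vertices (§2) and (b) non-adjacency of non-loops is transitive through non-isolated vertices
(`nonadj_trans_of_isMConvex`), hence has at most one positive eigenvalue (§1). [cite: BrandenHuh2019, §3.2 Thm. 3.10] -/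
theorem genPolyNorm_mem_lorentzian {J : Finset (σ →₀ ℕ)} {d : ℕ} (hJd : ∀ α ∈ J, α.degree = d)
    (hM : IsMConvex (J : Set (σ →₀ ℕ))) : genPolyNorm J ∈ lorentzian σ d := by
  match d with
  | 0 => exact mem_lorentzian_zero.2 ⟨isHomogeneous_genPolyNorm hJd, coeff_genPolyNorm_nonneg J⟩
  | 1 => exact mem_lorentzian_one.2 ⟨isHomogeneous_genPolyNorm hJd, coeff_genPolyNorm_nonneg J⟩
  | m + 2 =>
    refine mem_lorentzian_iff_forall_sigPos_hessian.2
      ⟨⟨isHomogeneous_genPolyNorm hJd, coeff_genPolyNorm_nonneg J, by rw [support_genPolyNorm]; exact hM⟩, fun β _ ↦ ?_⟩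
    rw [hessian_iterPderiv_genPolyNorm]
    exact sigPos_le_one_of_loops _ (fun i j h ↦ by rwa [add_right_comm])
      (fun i j hii hj ↦ hloop_of_isMConvex hM β i j hii hj)
      (fun i j k _ _ hj hij hjk ↦ nonadj_trans_of_isMConvex hM β i j k hj hij hjk)

/-! ## §4 Theorem 3.10: the three equivalent conditions -/

/-- **Brändén–Huh, Theorem 3.10, (3) ⇔ (2)**: for `J ⊆ Δ^d_n`, `J` is M-convex iff `f_J = Σ_{α∈J} w^α/α!` is Lorentzian
((2) ⇒ (3): the support of a Lorentzian polynomial is M-convex, `supp f_J = J`). [cite: BrandenHuh2019, §3.2 Thm. 3.10] -/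
theorem isMConvex_iff_genPolyNorm_mem_lorentzian {J : Finset (σ →₀ ℕ)} {d : ℕ} (hJd : ∀ α ∈ J, α.degree = d) :
    IsMConvex (J : Set (σ →₀ ℕ)) ↔ genPolyNorm J ∈ lorentzian σ d := by
  refine ⟨genPolyNorm_mem_lorentzian hJd, fun h ↦ ?_⟩
  rw [← support_genPolyNorm J]
  exact isMConvex_support_of_mem_lorentzian h

/-- **Brändén–Huh, Theorem 3.10, (3) ⇔ (1)**: for `J ⊆ Δ^d_n`, `J` is M-convex iff some Lorentzian polynomial (of degree `d`)
has support exactly `J`. [cite: BrandenHuh2019, §3.2 Thm. 3.10] -/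
theorem isMConvex_iff_exists_support_eq {J : Finset (σ →₀ ℕ)} {d : ℕ} (hJd : ∀ α ∈ J, α.degree = d) :
    IsMConvex (J : Set (σ →₀ ℕ)) ↔ ∃ f ∈ lorentzian σ d, {β : σ →₀ ℕ | coeff β f ≠ 0} = (J : Set (σ →₀ ℕ)) := by
  constructor
  · exact fun h ↦ ⟨genPolyNorm J, genPolyNorm_mem_lorentzian hJd h, support_genPolyNorm J⟩
  · rintro ⟨f, hf, hJ⟩
    rw [← hJ]
    exact isMConvex_support_of_mem_lorentzian hf

end GenPolyNorm

end Literature.Combinatorics.LorentzianPolynomials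

end
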